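import Summits.AtomisticToContinuum.FouriersLaw.Theses.HonestZwanzig
import Summits.AtomisticToContinuum.FouriersLaw.Theorems.HonestZwanzigFeshbachIdentitiesTimeReversal
import Summits.AtomisticToContinuum.FouriersLaw.Theorems.HonestZwanzigFeshbachIdentitiesLaplacePositivity
import Summits.AtomisticToContinuum.FouriersLaw.Theorems.HonestZwanzigFeshbachIdentitiesSiteEnergy
import Summits.AtomisticToContinuum.FouriersLaw.Theorems.PhononMeanFreePathIncoherentBoundedGrowthDynkin
import Summits.AtomisticToContinuum.FouriersLaw.Theorems.BondHeatUncertaintySubdiffusiveBondHeatKernelGibbsD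

/-!
# Stub `stub_feshbachIdentities` of line `LinAlg` — crux `HonestZwanzig.RobinCoercivity` (stmt-AtomisticToContinuum-12695)

The route support item `FeshbachIdentities` (stmt-AtomisticToContinuum-12697) of route `HonestZwanzig`, ASSEMBLED from
its landed support files `HonestZwanzigFeshbachIdentities{Correlations, Covariance, Kolmogorov, Continuity, ResolventA,
ResolventB, LaplacePositivity, SiteEnergy, TimeReversal}`, the kernel-level Gibbs invariance
`SubdiffusiveBondHeat.pinnedChain_gibbsMeasure_bind_transitionKernel` and the energy-dominated Dynkin engine
`IncoherentBounded.pinnedChain_dynkin_of_growth` (Dynkin's identity for `e_x`, `splitSite_dynkin_of_growth`, replaces the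
tenth support file `…SiteEnergyDynkin`, whose module is not built on the hub and cannot be imported). For the pinned anharmonic chain
`P = pinnedChain ω₂ lam β γ` (all parameters positive), `T > 0`, `N ≥ 2`, the canonical equilibrium objects
`μ = gibbsMeasure N T`, `P_t = transitionKernel N T T t`, the gadgets `corr`, `lap`, `cov`, `G(s)` of the route and the
admissible class `Adm = {f continuous, |f| ≤ A e^{H/(8T)}}` (nice with exponent `ϑ = 1/(8T)`, `2ϑ = 1/(4T) < 1/T`):

* clause (0) `μ.bind P_t = μ` — `pinnedChain_gibbsMeasure_bind_transitionKernel` at `t⁺`;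
* clause (i) integrability of `f`, of `f · P_t g` and of `corr(f,g)` on `(0,∞)` — part 1 (`…Correlations`);
* clause (ii) time reversal `corr(f,g)(t) = corr(g∘Θ, f∘Θ)(t)` — part 9 (`pinnedChain_corr_flip`);
* clause (iii) the two Kolmogorov identities against every split site energy `e_x` — `pinnedChain_kolmogorov_lap_flip`
  (first slot, part 9) and `pinnedChain_kolmogorov_lap` (second slot, part 3), fed by Dynkin's identity
  `splitSite_dynkin_of_growth` and the niceness of `e_x`, `L e_x` (`…SiteEnergy`);
* clause (iv-a) `ξᵀ Cov(e,e) ξ > 0` for `ξ ≠ 0` — `pinnedChain_sum_cov_pos` with the non-constancy witness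
  `pinnedChain_sum_splitSite_witness`;
* clause (iv-b) `ξᵀ G(s) ξ > 0` for `s > 0`, `ξ ≠ 0` — `pinnedChain_sum_lap_pos`.

`feshbachIdentities_of` is the assembly over abstract gadgets `Adm, corr, lap, cov, G` and an abstract site-energy
family `e` given with their defining equations; `stub_feshbachIdentities` instantiates it at the route's `let`-bound
objects by `rfl`. Sources: skeleton `Cruxes/RobinCoercivity/Lines/LinAlg.lean` of lead
`prover-line-stmt-AtomisticToContinuum-12695-0` (stub 1). Deliberately NOT here: the matrix identities, the Gram
duality, the Robin incidence bookkeeping and the flux bound (the other stubs of the line).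
-/

noncomputable section

open MeasureTheory ProbabilityTheory Filter Topology Set Function
open scoped NNReal ENNReal
open Literature.MathematicalPhysics.KineticTheory.HeatConduction
open Literature.MathematicalPhysics.KineticTheory OscillatorChain
open Summit.AtomisticToContinuum.FouriersLaw.Theorems.SubdiffusiveBondHeat
open Summit.AtomisticToContinuum.FouriersLaw.Theses.HonestZwanzig

namespace Summit.AtomisticToContinuum.FouriersLaw.Theorems.HonestZwanzig.Robin

/-! ### From admissible to nice -/

/-- An admissible observable (`|f| ≤ A e^{H/(8T)}`) is nice with exponent `ϑ = 1/(8T)` and the nonnegative constant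
`max A 0`. [folklore] -/
theorem abs_le_max_mul_exp_of_adm {N : ℕ} {ω₂ lam β γ T : ℝ} {f : PhaseSpace N → ℝ} {A : ℝ}
    (hA : ∀ z, |f z| ≤ A * Real.exp ((pinnedChain ω₂ lam β γ).hamiltonian N z / (8 * T))) (z : PhaseSpace N) :
    |f z| ≤ max A 0 * Real.exp (1 / (8 * T) * (pinnedChain ω₂ lam β γ).hamiltonian N z) := by
  rw [show 1 / (8 * T) * (pinnedChain ω₂ lam β γ).hamiltonian N z =
    (pinnedChain ω₂ lam β γ).hamiltonian N z / (8 * T) by ring]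
  exact (hA z).trans (mul_le_mul_of_nonneg_right (le_max_left _ _) (Real.exp_pos _).le)

section Assembly

variable {ω₂ lam β γ : ℝ} (hω : 0 < ω₂) (hl : 0 ≤ lam) (hβ : 0 < β) (hγ : 0 < γ) {N : ℕ} (hN : 2 ≤ N)
  {T : ℝ} (hT : 0 < T) (e : Fin N → PhaseSpace N → ℝ)
  (he : ∀ x z, e x z = z.2 x ^ 2 / 2 + (pinnedChain ω₂ lam β γ).U (z.1 x) +
    ∑ j : Fin N, ((if j.val = x.val + 1 then (pinnedChain ω₂ lam β γ).V (z.1 j - z.1 x) / 2 else 0) +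
      (if x.val = j.val + 1 then (pinnedChain ω₂ lam β γ).V (z.1 x - z.1 j) / 2 else 0)))

/-! ### The split site energies and their generator images are nice with exponent `1/(8T)` -/

include he hω hl hβ hT in
/-- The split site energies are continuous, even in the momenta, and `|e_x| ≤ 8T(N+2) e^{H/(8T)}` uniformly in the
site `x` (`pinnedChain_splitSite_nice` at `ϑ = 1/(8T)`). [folklore] -/
theorem splitSite_nice_eighth :
    (∀ x, Continuous (e x)) ∧ (∀ x (z : PhaseSpace N), e x (z.1, -z.2) = e x z) ∧
    0 ≤ ((N : ℝ) + 2) / (1 / (8 * T)) ∧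
    ∀ x y, |e x y| ≤ ((N : ℝ) + 2) / (1 / (8 * T)) *
      Real.exp (1 / (8 * T) * (pinnedChain ω₂ lam β γ).hamiltonian N y) := by
  have hϑ0 : 0 < 1 / (8 * T) := by positivity
  exact ⟨fun x => (pinnedChain_splitSite_nice e he hω hl hβ.le x).1,
    fun x => (pinnedChain_splitSite_nice e he hω hl hβ.le x).2.1, by positivity,
    fun x => (pinnedChain_splitSite_nice e he hω hl hβ.le x).2.2.2 _ hϑ0⟩

include he hω hl hβ hγ hT in
/-- The generator images `L e_x` are continuous and `|L e_x| ≤ C e^{H/(8T)}` with one constant `C ≥ 0` for all sites: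
`|L e_x| ≤ B (1+H)²` (`pinnedChain_generator_splitSite_nice`) and `(1+H)² ≤ (2e^ϑ/ϑ²) e^{ϑH}`. [folklore] -/
theorem generator_splitSite_nice_eighth :
    ∃ C : ℝ, 0 ≤ C ∧ ∀ x, Continuous ((pinnedChain ω₂ lam β γ).generator N T T (e x)) ∧
      ∀ y, |(pinnedChain ω₂ lam β γ).generator N T T (e x) y| ≤
        C * Real.exp (1 / (8 * T) * (pinnedChain ω₂ lam β γ).hamiltonian N y) := by
  set ϑ : ℝ := 1 / (8 * T) with hϑ
  have hϑ0 : 0 < ϑ := by positivity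
  set B : ℝ := (N : ℝ) ^ 2 * (3 + β) + (2 * T + 4) * γ with hB
  have hB0 : 0 ≤ B := by positivity
  refine ⟨B * (2 * Real.exp ϑ / ϑ ^ 2), by positivity, fun x => ?_⟩
  obtain ⟨-, hc, hb⟩ := pinnedChain_generator_splitSite_nice e he hω hl hβ.le hγ.le hT.le x
  refine ⟨hc, fun y => (hb y).trans ?_⟩
  have hH0 : 0 ≤ (pinnedChain ω₂ lam β γ).hamiltonian N y := pinnedChain_hamiltonian_nonneg hω.le hl hβ.le γ N y
  have hsq := Literature.MathematicalPhysics.KineticTheory.HeatConduction.one_add_sq_le_exp hH0 hϑ0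
  calc ((N : ℝ) ^ 2 * (3 + β) + (2 * T + 4) * γ) * (1 + (pinnedChain ω₂ lam β γ).hamiltonian N y) ^ 2
      ≤ B * (2 * Real.exp ϑ / ϑ ^ 2 * Real.exp (ϑ * (pinnedChain ω₂ lam β γ).hamiltonian N y)) :=
        mul_le_mul_of_nonneg_left hsq hB0
    _ = B * (2 * Real.exp ϑ / ϑ ^ 2) * Real.exp (ϑ * (pinnedChain ω₂ lam β γ).hamiltonian N y) := by ring

/-! ### Dynkin's identity for the split site energies -/

include he hω hl hβ hγ hT in
/-- **Dynkin's identity for the split site energy**: `P_r e_x(z) - e_x(z) = ∫₀ʳ P_s(L e_x)(z) ds` for all `r ≥ 0`, `z`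
(`ω₂, β, γ > 0`, `lam ≥ 0`, `N ≥ 1`, `T > 0`, constructed kernels). The energy-dominated Dynkin engine
`IncoherentBounded.pinnedChain_dynkin_of_growth` applied to the rescaled observable `e_x/(N+2)` (`0 ≤ e_x ≤ (N+2)H`,
`∂_{p_i} e_x = [i = x] p_i`, `|L e_x| ≤ B(1+H)²`), un-scaled by the homogeneity of `L` and of the integrals. This is the
statement `pinnedChain_splitSite_dynkin` of `…FeshbachIdentitiesSiteEnergyDynkin`, re-derived through the growth engine
so that this file does not depend on that module. [cite: CuneoEckmannHairerReyBellet2018, §3 eq. (3.2)–(3.4)] -/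
theorem splitSite_dynkin_of_growth (hN0 : 0 < N) (x : Fin N) (r : ℝ≥0) (z : PhaseSpace N) :
    (∫ y, e x y ∂((pinnedChain ω₂ lam β γ).transitionKernel N T T r z)) - e x z =
      ∫ s in (0 : ℝ)..(r : ℝ), ∫ y, (pinnedChain ω₂ lam β γ).generator N T T (e x) y
        ∂((pinnedChain ω₂ lam β γ).transitionKernel N T T s.toNNReal z) := by
  set c : ℝ := (N : ℝ) + 2 with hc
  have hc0 : 0 < c := by positivity
  have hcne : c ≠ 0 := hc0.ne'
  have hc1 : 1 ≤ c := by
    have : (0 : ℝ) ≤ N := Nat.cast_nonneg N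
    rw [hc]; linarith
  have hci0 : 0 ≤ c⁻¹ := inv_nonneg.2 hc0.le
  have hci1 : c⁻¹ ≤ 1 := inv_le_one_of_one_le₀ hc1
  obtain ⟨-, -, hbd, -⟩ := pinnedChain_splitSite_nice e he hω hl hβ.le x
  obtain ⟨-, -, hℓb⟩ := pinnedChain_generator_splitSite_nice e he hω hl hβ.le hγ.le hT.le x
  -- `C²` regularity of `e_x` (an energy profile)
  have hU2 : ContDiff ℝ 2 (pinnedChain ω₂ lam β γ).U := pinnedChain_contDiff_U ω₂ lam β γ
  have hV2 : ContDiff ℝ 2 (pinnedChain ω₂ lam β γ).V := pinnedChain_contDiff_V ω₂ lam β γ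
  have he2 : ContDiff ℝ 2 (e x) := by
    -- adapted from `…FeshbachIdentitiesSiteEnergyDynkin` (`pinnedChain_splitSite_dynkin`)
    rw [splitSite_eq e he x, splitSiteEnergy_eq_energyProfile _ x]
    refine (ContDiff.sum fun k _ => contDiff_const.mul ?_).add (ContDiff.sum fun k _ => ContDiff.sum fun l _ => ?_)
    · exact (((contDiff_apply ℝ ℝ k).comp contDiff_snd).pow 2 |>.div_const 2).add
        (hU2.comp ((contDiff_apply ℝ ℝ k).comp contDiff_fst))
    · by_cases hlk : l.val = k.val + 1
      · simp only [hlk, if_true]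
        exact contDiff_const.mul (hV2.comp (((contDiff_apply ℝ ℝ l).comp contDiff_fst).sub
          ((contDiff_apply ℝ ℝ k).comp contDiff_fst)))
      · simp only [hlk, if_false]; exact contDiff_const
  -- the hypotheses of the growth engine for `e_x / c`
  have he'2 : ContDiff ℝ 2 (fun y : PhaseSpace N => c⁻¹ * e x y) := contDiff_const.mul he2
  have he'0 : ∀ y : PhaseSpace N, 0 ≤ c⁻¹ * e x y := fun y => mul_nonneg hci0 (hbd y).1
  have he'H : ∀ y : PhaseSpace N, c⁻¹ * e x y ≤ (pinnedChain ω₂ lam β γ).hamiltonian N y := fun y => by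
    calc c⁻¹ * e x y ≤ c⁻¹ * (c * (pinnedChain ω₂ lam β γ).hamiltonian N y) :=
        mul_le_mul_of_nonneg_left (hbd y).2 hci0
      _ = (pinnedChain ω₂ lam β γ).hamiltonian N y := by rw [← mul_assoc, inv_mul_cancel₀ hcne, one_mul]
  have hd : ∀ (i : Fin N) (y : PhaseSpace N), |partialP i (fun w : PhaseSpace N => c⁻¹ * e x w) y| ≤ |y.2 i| := by
    intro i y
    rw [Summit.AtomisticToContinuum.FouriersLaw.Theorems.OddSectorIrreversibility.partialP_const_mul,
      partialP_splitSite e he x i y, abs_mul, abs_mul, abs_of_nonneg hci0]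
    have h1 : |(if i = x then (1 : ℝ) else 0)| * |y.2 i| ≤ |y.2 i| := by
      split_ifs <;> simp
    calc c⁻¹ * (|(if i = x then (1 : ℝ) else 0)| * |y.2 i|) ≤ 1 * |y.2 i| :=
        mul_le_mul hci1 h1 (by positivity) zero_le_one
      _ = |y.2 i| := one_mul _
  have hgen : ∀ y, (pinnedChain ω₂ lam β γ).generator N T T (fun w : PhaseSpace N => c⁻¹ * e x w) y =
      c⁻¹ * (pinnedChain ω₂ lam β γ).generator N T T (e x) y := fun y =>
    Summit.AtomisticToContinuum.FouriersLaw.Theorems.OddSectorIrreversibility.generator_const_mul _ N T T c⁻¹ (e x) y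
  have hB0 : 0 ≤ c⁻¹ * ((N : ℝ) ^ 2 * (3 + β) + (2 * T + 4) * γ) := by positivity
  have hℓ'b : ∀ y, |c⁻¹ * (pinnedChain ω₂ lam β γ).generator N T T (e x) y| ≤
      c⁻¹ * ((N : ℝ) ^ 2 * (3 + β) + (2 * T + 4) * γ) * (1 + (pinnedChain ω₂ lam β γ).hamiltonian N y) ^ 2 := by
    intro y
    rw [abs_mul, abs_of_nonneg hci0, mul_assoc]
    exact mul_le_mul_of_nonneg_left (hℓb y) hci0
  have key := Summit.AtomisticToContinuum.FouriersLaw.Theorems.IncoherentBounded.pinnedChain_dynkin_of_growth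
    hω hl hβ hγ hN0 hT he'2 he'0 he'H (fun y => hd _ y) (fun y => hd _ y) hgen hB0 hℓ'b r z
  simp only [integral_const_mul, intervalIntegral.integral_const_mul, ← mul_sub] at key
  have h := congrArg (fun t => c * t) key
  simp only [← mul_assoc, mul_inv_cancel₀ hcne, one_mul] at h
  exact h

/-! ### The assembly over abstract gadgets -/

include he hω hl hβ hγ hN hT in
/-- **`FeshbachIdentities`, assembled** over abstract gadgets: for the admissible class `Adm`, the truncated
correlation `corr`, its Laplace transform `lap`, the static covariance `cov`, the matrix `G(s) = [lap_s(e_x,e_y)]` and the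
split site energies `e`, each given with its defining equation, the four clauses of the route item hold —
(0) invariance of `μ_T` under `P_t`; (i)–(iii) integrability, time reversal and the two Kolmogorov identities for
admissible `f, g`; (iv-a) `Cov(e,e) > 0`; (iv-b) `G(s) > 0` for `s > 0`.
[cite: CuneoEckmannHairerReyBellet2018, Thm 2.13 (3)] -/
theorem feshbachIdentities_of (Adm : (PhaseSpace N → ℝ) → Prop)
    (hAdm : Adm = fun f => Continuous f ∧ ∃ A : ℝ, ∀ z,
      |f z| ≤ A * Real.exp ((pinnedChain ω₂ lam β γ).hamiltonian N z / (8 * T)))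
    (corr : (PhaseSpace N → ℝ) → (PhaseSpace N → ℝ) → ℝ → ℝ)
    (hcorr : corr = fun f g t =>
      (∫ z, f z * (∫ y, g y ∂((pinnedChain ω₂ lam β γ).transitionKernel N T T t.toNNReal z))
        ∂(pinnedChain ω₂ lam β γ).gibbsMeasure N T) -
      (∫ z, f z ∂(pinnedChain ω₂ lam β γ).gibbsMeasure N T) * (∫ z, g z ∂(pinnedChain ω₂ lam β γ).gibbsMeasure N T))
    (lap : ℝ → (PhaseSpace N → ℝ) → (PhaseSpace N → ℝ) → ℝ)
    (hlap : lap = fun s f g => ∫ t in Set.Ioi (0 : ℝ), Real.exp (-(s * t)) * corr f g t)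
    (cov : (PhaseSpace N → ℝ) → (PhaseSpace N → ℝ) → ℝ)
    (hcov : cov = fun f g => (∫ z, f z * g z ∂(pinnedChain ω₂ lam β γ).gibbsMeasure N T) -
      (∫ z, f z ∂(pinnedChain ω₂ lam β γ).gibbsMeasure N T) * (∫ z, g z ∂(pinnedChain ω₂ lam β γ).gibbsMeasure N T))
    (G : ℝ → Matrix (Fin N) (Fin N) ℝ) (hG : G = fun s => Matrix.of fun x y => lap s (e x) (e y)) :
    (∀ t : ℝ, 0 ≤ t → ((pinnedChain ω₂ lam β γ).gibbsMeasure N T).bind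
        (fun z => (pinnedChain ω₂ lam β γ).transitionKernel N T T t.toNNReal z) =
      (pinnedChain ω₂ lam β γ).gibbsMeasure N T) ∧
    (∀ f g : PhaseSpace N → ℝ, Adm f → Adm g →
      Integrable f ((pinnedChain ω₂ lam β γ).gibbsMeasure N T) ∧
      (∀ t : ℝ, 0 ≤ t → Integrable (fun z => f z *
        (∫ y, g y ∂((pinnedChain ω₂ lam β γ).transitionKernel N T T t.toNNReal z)))
        ((pinnedChain ω₂ lam β γ).gibbsMeasure N T)) ∧
      IntegrableOn (corr f g) (Set.Ioi 0) ∧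
      (∀ t : ℝ, 0 ≤ t → corr f g t = corr (fun z => g (z.1, -z.2)) (fun z => f (z.1, -z.2)) t) ∧
      (∀ s : ℝ, 0 < s → ∀ x : Fin N,
        s * lap s (e x) g - cov (e x) g =
          lap s (fun z => (pinnedChain ω₂ lam β γ).generator N T T (e x) (z.1, -z.2)) g ∧
        s * lap s f (e x) - cov f (e x) = lap s f ((pinnedChain ω₂ lam β γ).generator N T T (e x)))) ∧
    (∀ ξ : Fin N → ℝ, ξ ≠ 0 → 0 < ∑ x : Fin N, ∑ y : Fin N, ξ x * cov (e x) (e y) * ξ y) ∧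
    (∀ s : ℝ, 0 < s → ∀ ξ : Fin N → ℝ, ξ ≠ 0 → 0 < ∑ x : Fin N, ∑ y : Fin N, ξ x * G s x y * ξ y) := by
  have hN0 : 0 < N := by omega
  have hϑ0 : 0 < 1 / (8 * T) := by positivity
  have h2ϑ : 2 * (1 / (8 * T)) < 1 / T := by
    rw [show 2 * (1 / (8 * T)) = 1 / T * (1 / 4) by ring]
    exact mul_lt_of_lt_one_right (by positivity) (by norm_num)
  have hϑ1 : 1 / (8 * T) < 1 / T := by linarith
  obtain ⟨hec, heven, hCe, heb⟩ := splitSite_nice_eighth hω hl hβ hT e he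
  obtain ⟨Cℓ, hCℓ, hℓ⟩ := generator_splitSite_nice_eighth hω hl hβ hγ hT e he
  have hdyn := fun x => splitSite_dynkin_of_growth hω hl hβ hγ hT e he hN0 x
  subst hAdm hlap hcov hG
  subst hcorr
  beta_reduce
  refine ⟨fun t _ => pinnedChain_gibbsMeasure_bind_transitionKernel hω hl hβ.le hγ.le hN0 hT t.toNNReal,
    ?_, ?_, ?_⟩
  · rintro f g ⟨hf, A, hA⟩ ⟨hg, B, hB⟩
    have hfb := abs_le_max_mul_exp_of_adm hA
    have hgb := abs_le_max_mul_exp_of_adm hB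
    have hCf : 0 ≤ max A 0 := le_max_right _ _
    have hCg : 0 ≤ max B 0 := le_max_right _ _
    refine ⟨pinnedChain_integrable_nice hω hl hβ hT hϑ1 hf hfb,
      fun t _ => pinnedChain_integrable_mul_act_nice hω hl hβ hγ hN0 hT hϑ0 h2ϑ hf hg hfb hgb t.toNNReal,
      pinnedChain_integrableOn_corr_nice hω hl hβ hγ hN0 hT hϑ0 h2ϑ hf hg hCf hCg hfb hgb,
      fun t ht => pinnedChain_corr_flip hω hl hβ hγ hN hT hϑ0 h2ϑ hf hg hCf hCg hfb hgb ht,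
      fun s hs x => ⟨?_, ?_⟩⟩
    · exact pinnedChain_kolmogorov_lap_flip hω hl hβ hγ hN hT hϑ0 h2ϑ hg (hec x) (hℓ x).1 hCg hCe hCℓ hgb (heb x)
        (hℓ x).2 (heven x) (hdyn x) hs
    · exact pinnedChain_kolmogorov_lap hω hl hβ hγ hN0 hT hϑ0 h2ϑ hf (hec x) (hℓ x).1 hCf hCe hCℓ hfb (heb x)
        (hℓ x).2 (hdyn x) hs
  · intro ξ hξ
    obtain ⟨x₀, hx₀⟩ := Function.ne_iff.1 hξ
    exact pinnedChain_sum_cov_pos hω hl hβ.le hT hϑ0 h2ϑ hec hCe heb ξ (pinnedChain_sum_splitSite_witness e he hx₀)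
  · intro s hs ξ hξ
    obtain ⟨x₀, hx₀⟩ := Function.ne_iff.1 hξ
    simp only [Matrix.of_apply]
    exact pinnedChain_sum_lap_pos hω hl hβ hγ hN0 hT hϑ0 h2ϑ hec hCe heb ξ
      (pinnedChain_sum_splitSite_witness e he hx₀) hs

end Assembly

/-! ### The stub -/

/-- **Stub `stub_feshbachIdentities` of line `LinAlg`, crux `RobinCoercivity` (stmt-AtomisticToContinuum-12695):** the
route support item `FeshbachIdentities` (stmt-AtomisticToContinuum-12697) — for `pinnedChain ω₂ lam β γ` (all parameters
positive), `T > 0`, `N ≥ 2`: (0) `μ_T` is invariant under the equilibrium kernels `P_t`; (i) admissible observables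
(`continuous`, `O(e^{H/(8T)})`) have integrable `f`, `f · P_t g` and `corr(f,g) ∈ L¹(0,∞)`; (ii) time reversal
`corr(f,g)(t) = corr(g∘Θ, f∘Θ)(t)`; (iii) the Kolmogorov identities `s·lap_s(e_x,g) − Cov(e_x,g) = lap_s((Le_x)∘Θ, g)`,
`s·lap_s(f,e_x) − Cov(f,e_x) = lap_s(f, Le_x)`; (iv) `Cov(e,e)` and `G(s)` (`s > 0`) are positive definite.
Instance of `feshbachIdentities_of` at the route's `let`-bound gadgets. [cite: CuneoEckmannHairerReyBellet2018, Thm 2.13 (3)] -/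
theorem stub_feshbachIdentities : FeshbachIdentities := by
  intro ω₂ lam β γ hω hl hβ hγ T hT N hN P X μ corr lap cov e G Adm
  exact feshbachIdentities_of hω hl.le hβ hγ hN hT e (fun _ _ => rfl) Adm rfl corr rfl lap rfl cov rfl G rfl

end Summit.AtomisticToContinuum.FouriersLaw.Theorems.HonestZwanzig.Robin

end
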